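import Summits.ABC.IUTFork.Cor312StatementGenuineM
import Summits.ABC.IUTFork.Conditional.AbcOfSGenuineM
import HarnessLib

/-!
# Branch C — the DOWNSTREAM certificate at genuine data: `ABC` from the TYPED [IUTchIII] Cor. 3.12 `Cor312.Setting.Statement` at the
# summand-route M-level genuine real setting of every admissible datum, plus the hull-regime cone `hreg` — 2 explicit hypotheses, NO S / S_H

C scoreboard (INTAKE fold, abc-iut-C-cert-3 gen 2; the rung-currency note of abc-iut-w6-d081 11:48:10Z / abc-iut-w5-d244 11:43:09Z executed).
PROOF-ONLY file (no `def`, no new `Prop`, no instance, no notation; nothing re-typed). Every branch-C certificate so far reads «`ABC` ⟸ S (or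
S_H) + …», where S / S_H is the located sentence INSIDE the proof of [IUTchIII] Cor. 3.12 (Step (xi-d)–(xi-f)) and the certificate passes
through the typed COROLLARY ITSELF: S_H ⟹ `Cor312.Setting.Statement` (abc-iut-w5-d068 `statement_of_pilotKummerCompatHull`, given
`BridgeHyps`) ⟹ `I.Cor312Of` ⟹ … ⟹ `ABC`. abc-iut-w5-d244's `Cor312StatementGenuineM` (p442412 ✓, AUDITED SOUND abc-iut-w6-d081) isolates
the second arrow WITH NO HYPOTHESIS at the M-level genuine setting of a volume input's OWN ideles:
`cor312Of_of_statement_settingPrVolSharpM (hst : (settingPrVolSharpM …).Statement) : I.Cor312Of` (q-side = abc-iut-S2's number by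
abc-iut-w5-d244 p440575; Θ-side by abc-iut-s2-p8's closer p440655). Folding it BY NAME gives the certificate below, whose IUT-side hypothesis is
no longer a reading of Step (xi) but THE TYPED STATEMENT OF COR. 3.12 (abc-iut-c312-7's `Cor312.Setting.Statement`, DEFS-FROZEN:
`−|log(Θ)| ≠ ⊤ ∧ −|log(q)| ≤ −|log(Θ)|` for the setting's own pilot regions) at OUR genuine settings:

  «`ABC` ⟸ [C312] the typed Cor. 3.12 holds at the summand-route M-level genuine real setting of every ADMISSIBLE genuine Θ-volume datum
   (pilot regions read off the datum's OWN Θ- and q-ideles, abc-iut-w5-d033; ANY context binders) + [CONE] `hreg`» — explicit 2 = C312 1 · CONE 1,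
  NO S, NO S_H, NO pin / bridge / provenance / read / side binder.

RELATION TO THE S_H LINE (kernel, by name): v10M's per-datum hypothesis `hSH` IMPLIES `hst` (`Cor312Vol.statement_of_pilotKummerCompatHull`
at abc-iut-s2-p8's `bridgeHyps_settingPrVolSharpM_of_ideles`, p438078 — the route every `GenuineM*.cor312Of_of_SH` takes), so this certificate
is STRONGER than `abc_of_SH_v10M` (p442072) at equal count; conversely nothing here locates the gap — that is what the S/S_H lines and the
antecedent-status theorems are for (VERDICT §D). What the certificate documents for §K: modulo the volume computation's residue `hreg`,
the ENTIRE downstream chain [IUTchIII] Cor. 3.12 ⟹ [IUTchIV] Thm. 1.10 ⟹ Cor. 2.2 ⟹ Cor. 2.3 ⟹ abc is kernel-checked AT GENUINE DATA, with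
Cor. 3.12 entering as its own typed statement and nothing else.

HONEST FRAMING: this campaign LOCATES / CONDITIONALLY VERIFIES. Nothing here asserts that abc is proved or refuted, or that [IUTchIII]
Cor. 3.12 / Thm. 3.11 holds or fails, or takes a side on any author (Mochizuki / Scholze–Stix / Joshi / Dupuy–Hilado); `hst` is an assumption
label — the typed Cor. 3.12 at our settings, whose status is exactly the adjudication's subject (at the K-level sharp setting its (xi-f)
supplier S_H is refuted at deep data modulo their existence, p438886, and inhabited in the shallow tame window, p439445; the typed `Statement`
itself is equivalent there to the Θ-side inequality, p431727); `hreg` is the typed residue of [IUTchIV] Thm. 1.10's volume computation.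
typed ≠ proved; instantiated ≠ endorsed. [claim: Mochizuki2012, status: disputed]
[cite: Mochizuki2012, IUTchIII Cor. 3.12 p. 173–174; IUTchIV Thm. 1.10 p. 22–31, Cor. 2.2 (ii)–(iii) p. 43–46, Cor. 2.3 p. 47–55]
[cite: DupuyHilado2025, §3.4, Thm. 3.10.1]
-/

noncomputable section

open Set Function NumberField IsDedekindDomain

namespace Summit.ABC.IUTFork.Conditional

open Thm311 Thm311.Real Cor312 Cor312Vol Cor312Prov Literature.IUT.LogThetaLattice Literature.IUT.LogVolume
  Literature.IUT.HodgeTheaters Literature.IUT.LogVolume.ThetaData Literature.NumberTheory.NumberFields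

section Family

open Literature.NumberTheory.DiophantineGeometry.GenEll Summit.ABC.ABC.Theorems

/-- **`abc_of_cor312Statement_genuineM` (branch C DOWNSTREAM certificate at genuine data).** `ABC` from, per `λ`-line point `P`, prime `l`
and genuine Θ-volume datum `T`: DATA = the context binders of abc-iut-s2-p8's summand-route M-level sharp setting `settingPrVolSharpM T.D …`
(logs FIXED analytic; Θ- and q-ideles READ OFF the datum, abc-iut-w5-d033 `tOfIdeleData`/`tqM` of `ideleDataOf T.D T.isVolumeInputOf`;
`Sq := (GenuineM.finite_ratPlaces_under_S T.D).toFinset`, `htq1 := norm_tqM_eq_one_of_not_mem`, both THEOREMS — abc-iut-C-cert-3 p438616);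
HYPOTHESES = [C312] `hst` : the TYPED [IUTchIII] Cor. 3.12 `Cor312.Setting.Statement` of that setting, at ADMISSIBLE `(P,l)` only ·
[CONE] `hreg` (abc-iut-c312-8 p428563's, verbatim) — NOTHING ELSE (explicit 2; no S, no S_H, no pin / bridge / provenance / read / side binder).
Proof: `ThetaPartII.ABC_of_cor312_of_hullRegime` over abc-iut-w5-d244's hypothesis-free `cor312Of_of_statement_settingPrVolSharpM` (p442412).
«`ABC` follows from the typed Cor. 3.12 at these settings + `hreg`, as typed» — no side taken on [IUTchIII] Cor. 3.12; typed ≠ proved;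
instantiated ≠ endorsed. [claim: Mochizuki2012, status: disputed] -/
theorem abc_of_cor312Statement_genuineM
    -- DATA, per datum: the context binders of the summand-route M-level sharp setting (logs FIXED: analytic), the column data (NO qK, NO ρ: the typed Statement needs no region reading)
    (M : ∀ (P : NFPoint) (l : ℕ) (T : Cor22.ThetaVolumeDatumAt P l), Type) [∀ P l T, Field (M P l T)] [∀ P l T, NumberField (M P l T)]
    (archPk : ∀ (P : NFPoint) (l : ℕ) (T : Cor22.ThetaVolumeDatumAt P l), letI := T.instFieldF; letI := T.instNumberFieldF; letI := T.instAlgebraF; letI := T.instFieldK;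
        letI := T.instNumberFieldK; letI := T.instAlgebraK; letI := T.instFieldFbar; letI := T.instAlgebraFbar;
        letI := T.instAlgebraKFbar; letI := T.instIsElliptic;
      ∀ (j : (thetaIndexOfInitial T.D).Label) (vQ : (thetaIndexOfInitial T.D).VQ), Set ((logShellsOfInitialDH T.D (analyticLogvVal T.K)).Packet j vQ))
    (archSub : ∀ (P : NFPoint) (l : ℕ) (T : Cor22.ThetaVolumeDatumAt P l), letI := T.instFieldF; letI := T.instNumberFieldF; letI := T.instAlgebraF; letI := T.instFieldK;
        letI := T.instNumberFieldK; letI := T.instAlgebraK; letI := T.instFieldFbar; letI := T.instAlgebraFbar;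
        letI := T.instAlgebraKFbar; letI := T.instIsElliptic;
      ∀ (j : (thetaIndexOfInitial T.D).Label) (v : (thetaIndexOfInitial T.D).V), Set ((logShellsOfInitialDH T.D (analyticLogvVal T.K)).Packet j ((thetaIndexOfInitial T.D).over v)))
    (Ψ : ∀ (P : NFPoint) (l : ℕ) (T : Cor22.ThetaVolumeDatumAt P l), letI := T.instFieldF; letI := T.instNumberFieldF; letI := T.instAlgebraF; letI := T.instFieldK;
        letI := T.instNumberFieldK; letI := T.instAlgebraK; letI := T.instFieldFbar; letI := T.instAlgebraFbar;
        letI := T.instAlgebraKFbar; letI := T.instIsElliptic;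
      ℤ → ∀ v : (thetaIndexOfInitial T.D).V, v ∈ (thetaIndexOfInitial T.D).Vbad → Set ((logShellsOfInitialDH T.D (analyticLogvVal T.K)).StarPacket v))
    (act : ∀ (P : NFPoint) (l : ℕ) (T : Cor22.ThetaVolumeDatumAt P l), letI := T.instFieldF; letI := T.instNumberFieldF; letI := T.instAlgebraF; letI := T.instFieldK;
        letI := T.instNumberFieldK; letI := T.instAlgebraK; letI := T.instFieldFbar; letI := T.instAlgebraFbar;
        letI := T.instAlgebraKFbar; letI := T.instIsElliptic;
      ℤ → ∀ v : (thetaIndexOfInitial T.D).V, v ∈ (thetaIndexOfInitial T.D).Vbad → (logShellsOfInitialDH T.D (analyticLogvVal T.K)).StarPacket v → Module.End ℚ ((logShellsOfInitialDH T.D (analyticLogvVal T.K)).StarPacket v))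
    (Mmod : ∀ (P : NFPoint) (l : ℕ) (T : Cor22.ThetaVolumeDatumAt P l), letI := T.instFieldF; letI := T.instNumberFieldF; letI := T.instAlgebraF; letI := T.instFieldK;
        letI := T.instNumberFieldK; letI := T.instAlgebraK; letI := T.instFieldFbar; letI := T.instAlgebraFbar;
        letI := T.instAlgebraKFbar; letI := T.instIsElliptic;
      ℤ → ∀ j : (thetaIndexOfInitial T.D).LabelStar, Set ((logShellsOfInitialDH T.D (analyticLogvVal T.K)).GlobalPacket j.1))
    (region : ∀ (P : NFPoint) (l : ℕ) (T : Cor22.ThetaVolumeDatumAt P l), letI := T.instFieldF; letI := T.instNumberFieldF; letI := T.instAlgebraF; letI := T.instFieldK;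
        letI := T.instNumberFieldK; letI := T.instAlgebraK; letI := T.instFieldFbar; letI := T.instAlgebraFbar;
        letI := T.instAlgebraKFbar; letI := T.instIsElliptic;
      ℤ → ∀ j : (thetaIndexOfInitial T.D).LabelStar, FinDivisor (M P l T) → ∀ vQ : (thetaIndexOfInitial T.D).VQ, Set ((logShellsOfInitialDH T.D (analyticLogvVal T.K)).Packet j.1 vQ))
    (n : ∀ (P : NFPoint) (l : ℕ) (T : Cor22.ThetaVolumeDatumAt P l), ℤ)
    {HT : ∀ (P : NFPoint) (l : ℕ) (T : Cor22.ThetaVolumeDatumAt P l), Type} {LogLink : ∀ (P : NFPoint) (l : ℕ) (T : Cor22.ThetaVolumeDatumAt P l), HT P l T → HT P l T → Type}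
    {IsFull : ∀ (P : NFPoint) (l : ℕ) (T : Cor22.ThetaVolumeDatumAt P l), ∀ {s t : HT P l T}, LogLink P l T s t → Prop}
    (lat : ∀ (P : NFPoint) (l : ℕ) (T : Cor22.ThetaVolumeDatumAt P l), LGPGaussianLogThetaLattice (LogLink P l T) (IsFull P l T))
    {Frd : ∀ (P : NFPoint) (l : ℕ) (T : Cor22.ThetaVolumeDatumAt P l), Type} {IsoF : ∀ (P : NFPoint) (l : ℕ) (T : Cor22.ThetaVolumeDatumAt P l), Frd P l T → Frd P l T → Type} {Ob : ∀ (P : NFPoint) (l : ℕ) (T : Cor22.ThetaVolumeDatumAt P l), Frd P l T → Type}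
    {realify : ∀ (P : NFPoint) (l : ℕ) (T : Cor22.ThetaVolumeDatumAt P l), Frd P l T → Frd P l T} {Strip : ∀ (P : NFPoint) (l : ℕ) (T : Cor22.ThetaVolumeDatumAt P l), Type} {IsoS : ∀ (P : NFPoint) (l : ℕ) (T : Cor22.ThetaVolumeDatumAt P l), Strip P l T → Strip P l T → Type}
    {Mv : ∀ (P : NFPoint) (l : ℕ) (T : Cor22.ThetaVolumeDatumAt P l), letI := T.instFieldF; letI := T.instNumberFieldF; letI := T.instAlgebraF; letI := T.instFieldK;
        letI := T.instNumberFieldK; letI := T.instAlgebraK; letI := T.instFieldFbar; letI := T.instAlgebraFbar;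
        letI := T.instAlgebraKFbar; letI := T.instIsElliptic;
      ∀ v : (thetaIndexOfInitial T.D).V, v ∈ (thetaIndexOfInitial T.D).Vbad → Type}
    [∀ P l T v h, Monoid (Mv P l T v h)]
    (sig : ∀ (P : NFPoint) (l : ℕ) (T : Cor22.ThetaVolumeDatumAt P l), letI := T.instFieldF; letI := T.instNumberFieldF; letI := T.instAlgebraF; letI := T.instFieldK;
        letI := T.instNumberFieldK; letI := T.instAlgebraK; letI := T.instFieldFbar; letI := T.instAlgebraFbar;
        letI := T.instAlgebraKFbar; letI := T.instIsElliptic;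
      GlobalLGPFrobenioidSignature (thetaIndexOfInitial T.D).lstar (thetaIndexOfInitial T.D).V (· ∈ (thetaIndexOfInitial T.D).Vbad) (Frd P l T) (IsoF P l T) (Ob P l T) (realify P l T)
        (Strip P l T) (IsoS P l T) (Mv P l T))
    (split : ∀ (P : NFPoint) (l : ℕ) (T : Cor22.ThetaVolumeDatumAt P l), SplittingMonoids (Mv P l T))
    {ObΔ : ∀ (P : NFPoint) (l : ℕ) (T : Cor22.ThetaVolumeDatumAt P l), Type}
    {N : ∀ (P : NFPoint) (l : ℕ) (T : Cor22.ThetaVolumeDatumAt P l), letI := T.instFieldF; letI := T.instNumberFieldF; letI := T.instAlgebraF; letI := T.instFieldK;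
        letI := T.instNumberFieldK; letI := T.instAlgebraK; letI := T.instFieldFbar; letI := T.instAlgebraFbar;
        letI := T.instAlgebraKFbar; letI := T.instIsElliptic;
      ∀ v : (thetaIndexOfInitial T.D).V, v ∈ (thetaIndexOfInitial T.D).Vbad → Type}
    [∀ P l T v h, Monoid (N P l T v h)] (qData : ∀ (P : NFPoint) (l : ℕ) (T : Cor22.ThetaVolumeDatumAt P l), QPilotData (ObΔ P l T) (N P l T))
    -- [C312] the TYPED [IUTchIII] Cor 3.12 `Statement` at the summand-route M-level genuine real setting of the datum's OWN ideles, ADMISSIBLE (P,l) only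
    (hst : ∀ (P : NFPoint), P ∈ UP → ∀ (l : ℕ), l.Prime → 5 ≤ l →
      Cor22.AdmitsCore P → Cor22.CondP2 P l → Cor22.CondP5 P l → Cor22.CondP6 P l →
      ∀ (T : Cor22.ThetaVolumeDatumAt P l), letI := T.instFieldF; letI := T.instNumberFieldF; letI := T.instAlgebraF; letI := T.instFieldK;
        letI := T.instNumberFieldK; letI := T.instAlgebraK; letI := T.instFieldFbar; letI := T.instAlgebraFbar;
        letI := T.instAlgebraKFbar; letI := T.instIsElliptic;
      (settingPrVolSharpM T.D (logvAnalyticVal_analyticLogvVal (K := T.K)) (tOfIdeleData T.D (ideleDataOf T.D T.isVolumeInputOf))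
          (fun u x => tqM T.D (ratChar u) u (natCast_ratChar_mem u) (ideleDataOf T.D T.isVolumeInputOf) x)
          (M P l T) (archPk P l T) (archSub P l T) (Ψ P l T) (act P l T)
          (Mmod P l T) (region P l T) (n P l T) (lat P l T) (sig P l T) (split P l T) (qData P l T)
          (fun u x => tqM_ne_zero T.D (ratChar u) u (natCast_ratChar_mem u) (ideleDataOf T.D T.isVolumeInputOf) x)
          (GenuineM.finite_ratPlaces_under_S T.D).toFinset
          (fun u x hu => norm_tqM_eq_one_of_not_mem T.D (ratChar u) u (natCast_ratChar_mem u) (ideleDataOf T.D T.isVolumeInputOf) x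
            fun hx => hu ((Set.Finite.mem_toFinset _).mpr ⟨x, hx⟩))).Statement)
    -- [S]/[S_H] none · [PIN] none · [PROV] none · [BRIDGE] none · [READ] none · [FACT] none · [SIDE] none · [CONE] c312-8 p428563's `hreg`, verbatim
    (hreg : ∀ P : NFPoint, P ∈ UP → ∀ l : ℕ, l.Prime → 5 ≤ l →
      Cor22.AdmitsCore P → Cor22.CondP2 P l → Cor22.CondP5 P l → Cor22.CondP6 P l →
      ∀ T : Cor22.ThetaVolumeDatumAt P l,
        (letI := T.instFieldF; letI := T.instNumberFieldF; letI := T.instAlgebraF; letI := T.instFieldK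
         letI := T.instNumberFieldK; letI := T.instAlgebraK; letI := T.instFieldFbar; letI := T.instAlgebraFbar
         letI := T.instAlgebraKFbar; letI := T.instIsElliptic
         ¬ (∀ p ∈ T.I.supportPrimes, ∀ v w : placesOver (fieldOfModuli T.E) p,
            (Summit.ABC.IUTFork.DHData.ofInput T.I).logQloc p v = (Summit.ABC.IUTFork.DHData.ofInput T.I).logQloc p w)) →
        T.HullEstimateOf
          (((l : ℝ) + 1) / 4 *
            ((1 + 12 * (Cor22.dmod P : ℝ) / l) * (P.logDiff + Cor22.logCondAvoid P {2, l})
              + 2 * Real.log l + 52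
              + 20 / 3 * Real.log (((2 ^ 12 * 3 ^ 3 * 5 * Cor22.dmod P : ℕ) : ℝ) * (l : ℝ))
                * (Nat.primeCounting (2 ^ 12 * 3 ^ 3 * 5 * Cor22.dmod P * l) : ℝ))))
    : _root_.ABC := by
  -- the typed Cor 3.12 at every ADMISSIBLE genuine Θ-volume datum ⟹ S2's Dupuy–Hilado inequality `I.Cor312Of` with NO further hypothesis
  -- (abc-iut-w5-d244 p442412), then the (U)-line tail [IUTchIV] Thm 1.10 ⟹ Cor 2.2 ⟹ Cor 2.3 ⟹ abc (abc-iut-c312-8 / abc-iut-S3 capstone p428563)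
  refine ThetaPartII.ABC_of_cor312_of_hullRegime (fun P hP l hl h5 hc h2 h5' h6 T => ?_) hreg
  letI := T.instFieldF; letI := T.instNumberFieldF; letI := T.instAlgebraF; letI := T.instFieldK
  letI := T.instNumberFieldK; letI := T.instAlgebraK; letI := T.instFieldFbar; letI := T.instAlgebraFbar
  letI := T.instAlgebraKFbar; letI := T.instIsElliptic
  exact cor312Of_of_statement_settingPrVolSharpM T.D (logvAnalyticVal_analyticLogvVal (K := T.K)) T.isVolumeInputOf (M P l T)
    (archPk P l T) (archSub P l T) (Ψ P l T) (act P l T) (Mmod P l T) (region P l T) (n P l T) (lat P l T) (sig P l T) (split P l T)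
    (qData P l T) (GenuineM.finite_ratPlaces_under_S T.D).toFinset
    (fun u x hu => norm_tqM_eq_one_of_not_mem T.D (ratChar u) u (natCast_ratChar_mem u) (ideleDataOf T.D T.isVolumeInputOf) x
      fun hx => hu ((Set.Finite.mem_toFinset _).mpr ⟨x, hx⟩))
    (hst P hP l hl h5 hc h2 h5' h6 T)

end Family

end Summit.ABC.IUTFork.Conditional

end
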